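import Summits.Ventures.QEC.Theorems.BB108DistanceCertificateNoZLogicalBelowTen108
import Summits.Ventures.QEC.Theorems.BB108DistanceCertificateWeightTenZLogical108
import Summits.Ventures.QEC.Theorems.BB108DistanceCertificateEightLogicalQubits108
import HarnessLib

/-!
# Route BB108DistanceCertificate, item Target (stmt-Ventures-19827): `QC(x³+y+y², y³+x+x²)` on `ℤ₉ × ℤ₆` has
# parameters `[[108, 8, 10]]` (Bravyi et al. 2024 Table 1 row 3) — `Summit.Ventures.QEC.BB.BB108_8_10_claim`

The route's glue `closes` on the three closed items: `noZLogicalBelowTen108_proof` (qec-search-10 g2: 3-block `bz_aut`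
certificate `e1203653…`, KERNEL enumeration with the byte-parallel leaf, on type-10's `bzAut_lower_sound` and type-12's
orbit cover), `weightTenZLogical108_proof` (qec-type-10, the certificate's weight-10 witness) and
`EightLogicalQubits108_proof` (qec-type-02, rank certificates `r_X = r_Z = 50`). Tier = that of the lower bound.
-/

namespace Summit.Ventures.QEC.Census.BB108

open Literature.InformationTheory.QuantumCodes Summit.Ventures.QEC.BB
  Summit.Ventures.QEC.Theses.BB108DistanceCertificate

/-- **Item Target, PROVED — `[[108, 8, 10]]`**: `HasParams BB.bb108 108 8 10`. -/
theorem target108_proof : Summit.Ventures.QEC.Theses.BB108DistanceCertificate.Target :=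
  closes noZLogicalBelowTen108_proof weightTenZLogical108_proof
    Summit.Ventures.QEC.Theorems.EightLogicalQubits108_proof

/-- **The registered CLAIM leaf discharged**: `Summit.Ventures.QEC.BB.BB108_8_10_claim`. -/
theorem BB108_8_10_claim_holds : Summit.Ventures.QEC.BB.BB108_8_10_claim := target108_proof

/-- `d_Z(BB.bb108) = 10`. -/
theorem bb108_dZ : BB.bb108.css.dZ = 10 := (dX_eq_of_hasParams BB108_8_10_claim_holds).2

/-- `d_X(BB.bb108) = 10`. -/
theorem bb108_dX : BB.bb108.css.dX = 10 := (dX_eq_of_hasParams BB108_8_10_claim_holds).1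

/-- `d(BB.bb108) = 10`. -/
theorem bb108_d : BB.bb108.d = 10 := BB108_8_10_claim_holds.2.2

end Summit.Ventures.QEC.Census.BB108
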